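import Literature.NumberTheory.GaloisRepresentations.TateProjectiveLifting
import Literature.NumberTheory.Automorphic.SerreConjectureProofs
import Literature.NumberTheory.Automorphic.BaseChangeCyclicCuspidal
import Literature.NumberTheory.Automorphic.GelbartJacquetSymmSquare
import Literature.NumberTheory.Automorphic.TunnellOctahedralGlobalProofs
import Literature.NumberTheory.Automorphic.AlgebraicityTwist
import Literature.NumberTheory.Automorphic.CuspidalRepDataOfL2Satake
import Literature.NumberTheory.Automorphic.Sweep1SymmetricPowerGelbartHolds
import Literature.NumberTheory.Automorphic.AutomorphicTwistWeightOne
import Literature.NumberTheory.Automorphic.LanglandsTunnellLSeriesProofs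
import Literature.NumberTheory.Automorphic.GLnAdelicStructureProofs
import Literature.NumberTheory.GaloisRepresentations.SerreWeightLowerBoundProofs
import Literature.NumberTheory.GaloisRepresentations.CubicResidueSymbol
import Literature.NumberTheory.Automorphic.GelbartJacquetAdjointLiftArchimedean
import HarnessLib

/-!
# Named archimedean facts and infinity types for `ResidualAutomorphyOdd` (helper for item stmt-Langlands-13759)

Two published archimedean facts stated inline for relocation under `Literature/` (Gelbart–Jacquet's
adjoint lift at the archimedean place, `GelbartJacquet_adjoint_lift_archimedean`; the archimedean
parameter of the automorphic representation of a holomorphic newform, `newform_archParameter`), the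
additive adjoint of an archimedean parameter (`adArchParams`), and the infinity types of the discrete
series of weight `k` on `GL₂/ℚ` and of its adjoint lift on `GL₃/ℚ` (`dkInfinityType`, `adInfinityType`).
-/

set_option linter.dupNamespace false -- project-wide option (lakefile weak.linter.dupNamespace); `Summit.Langlands.Langlands` is the mandated namespace

noncomputable section

open scoped NumberField Classical Polynomial MatrixGroups
open Filter IsDedekindDomain Polynomial
open Literature.NumberTheory.Automorphic Literature.NumberTheory.GaloisRepresentations
open Literature.NumberTheory.EllipticCurves.ModularForms

namespace Summit.Langlands.Langlands.Theorems.ResidualAutomorphyOdd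

/-! ### The additive adjoint of an archimedean parameter

The two archimedean named facts (`GelbartJacquet_adjoint_lift_archimedean`, `newform_archParameter`)
live in `Literature.NumberTheory.Automorphic.GelbartJacquetAdjointLiftArchimedean` (relocated by the gate,
p83425). -/

/-- **Additive adjoint of an archimedean parameter**: for a multiset `χ` of exponents, the multiset
`{a - b : (a, b) ∈ χ × χ}` with one copy of `0` removed; for `χ = {a, b}` this is `{a - b, b - a, 0}`,
the exponents of `Ad ∘ φ` restricted to `ℂˣ` when `φ|_{ℂˣ} = z^a ⊕ z^b` (Gelbart–Jacquet 1978,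
(3.2.2)–(3.2.3): `τ ⊗ τ̃ = λ ⊕ 1`). Additive twin of `adParams`. -/
def adArchParams (χ : Multiset ℂ) : Multiset ℂ :=
  ((χ ×ˢ χ).map fun p => p.1 - p.2).erase 0

/-- `Ad{a, b} = {a - b, b - a, 0}` additively. -/
theorem adArchParams_pair (a b : ℂ) : adArchParams {a, b} = {a - b, b - a, 0} := by
  simp [adArchParams, Multiset.insert_eq_cons, Multiset.cons_product]
  rw [Multiset.cons_swap (a - b) 0, Multiset.erase_cons_head]

/-! ### Infinity types -/

/-- The infinity type of the holomorphic discrete series of weight `k` on `GL₂/ℚ`. -/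
def dkInfinityType (k : ℤ) : InfinityType ℚ 2 := fun _ =>
  {⟨((k : ℂ) - 1) / 2, (1 - (k : ℂ)) / 2, ⟨k - 1, by push_cast; ring⟩⟩,
    ⟨(1 - (k : ℂ)) / 2, ((k : ℂ) - 1) / 2, ⟨1 - k, by push_cast; ring⟩⟩}

/-- The infinity type of the adjoint lift of a weight-`k` form on `GL₃/ℚ`. -/
def adInfinityType (k : ℤ) : InfinityType ℚ 3 := fun _ =>
  {⟨(k : ℂ) - 1, 1 - (k : ℂ), ⟨2 * k - 2, by push_cast; ring⟩⟩,
    ⟨1 - (k : ℂ), (k : ℂ) - 1, ⟨2 - 2 * k, by push_cast; ring⟩⟩,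
    ⟨0, 0, ⟨0, by simp⟩⟩}

/-- `dkInfinityType k` is well formed. -/
theorem isWellFormed_dkInfinityType (k : ℤ) : (dkInfinityType k).IsWellFormed := by
  refine ⟨fun σ => by simp [dkInfinityType], fun σ => ?_⟩
  change ({_, _} : Multiset ArchWeight) = Multiset.map ArchWeight.swap {_, _}
  rw [Multiset.insert_eq_cons, Multiset.map_cons, Multiset.map_singleton, ← Multiset.insert_eq_cons,
    Multiset.pair_comm]
  congr 1

/-- `adInfinityType k` is well formed. -/
theorem isWellFormed_adInfinityType (k : ℤ) : (adInfinityType k).IsWellFormed := by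
  refine ⟨fun σ => by simp [adInfinityType], fun σ => ?_⟩
  change ({_, _, _} : Multiset ArchWeight) = Multiset.map ArchWeight.swap {_, _, _}
  rw [Multiset.insert_eq_cons, Multiset.insert_eq_cons, Multiset.map_cons, Multiset.map_cons,
    Multiset.map_singleton, Multiset.cons_swap]
  congr 1

/-- The holomorphic exponents of `dkInfinityType k`. -/
theorem map_a_dkInfinityType (k : ℤ) (σ : ℚ →+* ℂ) :
    (dkInfinityType k σ).map ArchWeight.a = {((k : ℂ) - 1) / 2, (1 - (k : ℂ)) / 2} := by
  simp [dkInfinityType]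

/-- The holomorphic exponents of `adInfinityType k`. -/
theorem map_a_adInfinityType (k : ℤ) (σ : ℚ →+* ℂ) :
    (adInfinityType k σ).map ArchWeight.a = {(k : ℂ) - 1, 1 - (k : ℂ), 0} := by
  simp [adInfinityType]

/-- `Ad` of the exponents of the weight-`k` discrete series. -/
theorem adArchParams_dk (k : ℤ) :
    adArchParams {((k : ℂ) - 1) / 2, (1 - (k : ℂ)) / 2} = {(k : ℂ) - 1, 1 - (k : ℂ), 0} := by
  rw [adArchParams_pair]
  congr 1
  · ring
  · congr 1; ring

end Summit.Langlands.Langlands.Theorems.ResidualAutomorphyOdd
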